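import Summits.QuantumFields.YangMills.Theorems.LuscherReductionTwistedTraceScalingBODefectTailRate
import Summits.QuantumFields.YangMills.Theorems.LuscherReductionTwistedTraceScalingBOFibreBall
import HarnessLib

/-!
# (C4-CORE γ-rates, shell piece) THE DUAL-BO SHELL RATE `b_B² = 8N_hi G/((1−η)²(1−κ)M₂in N̄)` IS `o(λ_bare)`
# (lane A of S-BASE, crux `TwistedTraceScaling` stmt-QuantumFields-20203, C4-CORE, the (OD) pen; `pub/ym-fleet/ym-luscher-20007-p1/HANDOFF-g20.md` (γ))

With the record data `N_hi = N̄(1+C_p(43β^{-s})²)`, `G = e^{−β·gap·(r_F/12)²}·π(univ)`, `η = β^{-1/5}`, `κ = C_q(43β^{-s})²`, `N̄ = fpWeightBar(β^{-1})` and the inner Gaussian mass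
`M₂in(β) = ∫ 𝟙_{‖x̂‖≤r_F/12} e^{−2E} e^{−‖P_Γx̂‖²/β^{-2}} dπ` (of `…BORecordGamma.recordGamma_le_two_mul_inner`), the rate of `…BOShellCurrency.sq_le_of_shell_currency` satisfies
★★ `shell_rate_small` — `∀ a > 0, ∀ᶠ β, b_B(β)² ≤ a·bareLambda(L³β)`: `β r_F² = ℓ²` makes `G = e^{−(gap/144)ℓ²}π(univ)`, and `M₂in ≥ e^{−99}·π{‖x̂‖ < β^{-1}} ≥ e^{−99}c_b·(β^{-1})^{6|E|}`
(`…BOFibreBall.inner_gauss_mass_ge` at radius `β^{-1} ≤ r_F/12`, `…BOFibreBall.orthoTransverse_real_ball_ge`), so `b_B² ≤ P·e^{−(gap/144)ℓ²}/(β^{-1})^{6|E|}`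
(`…BODefectRates.sq_rate_small_of_exp_btLog_sq`).
HONEST FRAMING: bookkeeping for a stub of a child of the CONDITIONAL route R2b1; the hOD assembly, (B-ST), C4-CORE remain OPEN; not a gap, not Clay.
-/

set_option autoImplicit false

noncomputable section

open MeasureTheory Filter Topology Real
open Literature.MathematicalPhysics.QuantumFieldTheory
open Literature.MathematicalPhysics.QuantumLattice

namespace Summit.QuantumFields.YangMills.Theorems.FemtoTransferGap.TwoLattice.ConstTube

open Summit.QuantumFields.YangMills.Theorems.FemtoTransferGap
open Summit.QuantumFields.YangMills.Theorems.FemtoTransferGap.TwoLattice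
open Summit.QuantumFields.YangMills.Theorems.FemtoTransferGap.TwoLattice.Toron (gap_pos)

variable {L : ℕ} [NeZero L]

omit [NeZero L] in
/-- `β^{-1} ≤ r_F/12` eventually. [folklore] -/
theorem eventually_powScale_one_le_rf_div : ∀ᶠ β : ℝ in atTop, powScale 1 β ≤ (min (1 / 40) (powScale (1 / 2) β * btLog β)) / 12 := by
  have hr : Tendsto (fun β : ℝ => powScale (1 / 2) β * btLog β) atTop (𝓝 0) := by
    have h := tendsto_powScale_mul_btLog_pow (p := 1 / 2) (by norm_num) 1
    simpa only [pow_one] using h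
  filter_upwards [hr.eventually (eventually_le_nhds (by norm_num : (0:ℝ) < 1 / 40)),
    (tendsto_powScale (σ := 1 / 2) (by norm_num)).eventually (eventually_le_nhds (by norm_num : (0:ℝ) < 1 / 12))] with β h hx
  rw [min_eq_right h]
  have hx0 : 0 < powScale (1 / 2) β := powScale_pos _ _
  have hℓ : 1 ≤ btLog β := one_le_btLog β
  have e : powScale 1 β = powScale (1 / 2) β * powScale (1 / 2) β := by rw [powScale_mul_powScale]; norm_num
  rw [e]
  have h1 : powScale (1 / 2) β * powScale (1 / 2) β ≤ powScale (1 / 2) β * (1 / 12) := mul_le_mul_of_nonneg_left hx hx0.le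
  have h2 : powScale (1 / 2) β * (1 / 12) ≤ powScale (1 / 2) β * btLog β / 12 := by
    rw [mul_div_assoc]; exact mul_le_mul_of_nonneg_left (by linarith) hx0.le
  linarith

/-- ★ **POLYNOMIAL FLOOR FOR THE INNER GAUSSIAN MASS**: eventually `e^{−99}·c_b·(β^{-1})^{6|E|} ≤ M₂in(β)`, `c_b = ((1/(20|E|))³/10)^{|E|}`. [folklore] -/
theorem inner_mass_poly_floor :
    ∀ᶠ β : ℝ in atTop, Real.exp (-99) * ((1 / (20 * Fintype.card (Edge 3 L))) ^ 3 / 10) ^ Fintype.card (Edge 3 L) * powScale 1 β ^ (6 * Fintype.card (Edge 3 L)) ≤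
      ∫ v, {v : Edge 3 L → Fin 3 → ℝ | ‖linkEmbed L v‖ ≤ (min (1 / 40) (powScale (1 / 2) β * btLog β)) / 12}.indicator (fun _ => (1 : ℝ)) v *
          (Real.exp (-(stiffGaussExp L (β / 2) β (linkEmbed L v))) ^ 2 * Real.exp (-(‖(gaugeModes L).starProjection (linkEmbed L v)‖ ^ 2 / powScale 1 β ^ 2))) ∂orthoTransverse L := by
  haveI := isFiniteMeasure_orthoTransverse L
  have hE : (0 : ℝ) < Fintype.card (Edge 3 L) := by exact_mod_cast Fintype.card_pos
  filter_upwards [eventually_powScale_one_le_rf_div, eventually_ge_atTop (1 : ℝ),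
    (tendsto_powScale (σ := 1) one_pos).eventually (eventually_le_nhds (show (0:ℝ) < 1 / 50 by norm_num))] with β hρR hβ1 hps50
  have hps : 0 < powScale 1 β := powScale_pos 1 β
  have hps1 : powScale 1 β = β⁻¹ := by rw [powScale_eq hβ1, Real.rpow_neg_one]
  have hlow := inner_gauss_mass_ge (L := L) (t := β / 2) (b := β) (s := powScale 1 β) (ρ := powScale 1 β) (R := (min (1 / 40) (powScale (1 / 2) β * btLog β)) / 12) (by positivity) (by positivity) hps hρR
  refine le_trans ?_ hlow
  -- the exponent: `(2(96β/2+β) + 1/ps1²)·ps1² = 98β·ps1² + 1 = 98/β + 1 ≤ 99`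
  have hexp : Real.exp (-99) ≤ Real.exp (-((2 * (96 * (β / 2) + β) + 1 / powScale 1 β ^ 2) * powScale 1 β ^ 2)) := by
    rw [Real.exp_le_exp, neg_le_neg_iff]
    have e : (2 * (96 * (β / 2) + β) + 1 / powScale 1 β ^ 2) * powScale 1 β ^ 2 = 98 * β * powScale 1 β ^ 2 + 1 := by field_simp; ring
    rw [e, hps1]
    have : 98 * β * β⁻¹ ^ 2 = 98 / β := by field_simp
    rw [this]
    have h98 : 98 / β ≤ 98 := by rw [div_le_iff₀ (by linarith)]; nlinarith
    linarith
  -- the ball: `δ = min(1/50, ps1²/(20|E|)) = ps1²/(20|E|)` since `ps1 ≤ 1/50`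
  have hball := orthoTransverse_real_ball_ge (L := L) hps
  have hmin : min (1 / 50) (powScale 1 β ^ 2 / (20 * Fintype.card (Edge 3 L))) = powScale 1 β ^ 2 / (20 * Fintype.card (Edge 3 L)) := by
    refine min_eq_right ?_
    rw [div_le_iff₀ (by positivity)]
    have hE1 : (1 : ℝ) ≤ Fintype.card (Edge 3 L) := by exact_mod_cast Fintype.card_pos
    nlinarith [hps50, hps.le]
  rw [hmin] at hball
  have e2 : ((powScale 1 β ^ 2 / (20 * Fintype.card (Edge 3 L))) ^ 3 / 10) ^ Fintype.card (Edge 3 L) =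
      ((1 / (20 * Fintype.card (Edge 3 L))) ^ 3 / 10) ^ Fintype.card (Edge 3 L) * powScale 1 β ^ (6 * Fintype.card (Edge 3 L)) := by
    rw [pow_mul, ← mul_pow]; congr 1; field_simp
  rw [e2] at hball
  calc Real.exp (-99) * ((1 / (20 * Fintype.card (Edge 3 L))) ^ 3 / 10) ^ Fintype.card (Edge 3 L) * powScale 1 β ^ (6 * Fintype.card (Edge 3 L))
      = Real.exp (-99) * (((1 / (20 * Fintype.card (Edge 3 L))) ^ 3 / 10) ^ Fintype.card (Edge 3 L) * powScale 1 β ^ (6 * Fintype.card (Edge 3 L))) := by ring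
    _ ≤ Real.exp (-((2 * (96 * (β / 2) + β) + 1 / powScale 1 β ^ 2) * powScale 1 β ^ 2)) * (orthoTransverse L).real {v | ‖linkEmbed L v‖ < powScale 1 β} :=
        mul_le_mul hexp hball (by positivity) (Real.exp_pos _).le

set_option maxHeartbeats 800000 in
-- explicit record expressions.
/-- ★★ **THE SHELL RATE IS `o(λ_bare)`** (see the module docstring). [cite: Luscher1983, §3] -/
theorem shell_rate_small (hL : 2 ≤ L) {s : ℝ} (hs : 0 < s) (Cp Cq : ℝ) :
    ∀ a : ℝ, 0 < a → ∀ᶠ β : ℝ in atTop,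
      8 * (fpWeightBar L (powScale 1 β) * (1 + Cp * (43 * powScale s β) ^ 2)) * (Real.exp (-(β * (2 - 2 * Real.cos (2 * Real.pi / L)) * ((min (1 / 40) (powScale (1 / 2) β * btLog β)) / 12) ^ 2)) * (orthoTransverse L Set.univ).toReal) /
        ((1 - powScale (1 / 5) β) ^ 2 * (1 - Cq * (43 * powScale s β) ^ 2) *
          (∫ v, {v : Edge 3 L → Fin 3 → ℝ | ‖linkEmbed L v‖ ≤ (min (1 / 40) (powScale (1 / 2) β * btLog β)) / 12}.indicator (fun _ => (1 : ℝ)) v *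
            (Real.exp (-(stiffGaussExp L (β / 2) β (linkEmbed L v))) ^ 2 * Real.exp (-(‖(gaugeModes L).starProjection (linkEmbed L v)‖ ^ 2 / powScale 1 β ^ 2))) ∂orthoTransverse L) *
          fpWeightBar L (powScale 1 β)) ≤ a * bareLambda ((L : ℝ) ^ 3 * β) := by
  haveI := isFiniteMeasure_orthoTransverse L
  have hE : (0 : ℝ) < Fintype.card (Edge 3 L) := by exact_mod_cast Fintype.card_pos
  set gap : ℝ := 2 - 2 * Real.cos (2 * Real.pi / L) with hgap
  have hgap0 : 0 < gap := gap_pos L hL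
  set Pm : ℝ := (orthoTransverse L Set.univ).toReal with hPm
  have hPm0 : 0 ≤ Pm := ENNReal.toReal_nonneg
  set cb : ℝ := Real.exp (-99) * ((1 / (20 * Fintype.card (Edge 3 L))) ^ 3 / 10) ^ Fintype.card (Edge 3 L) with hcb
  have hcb0 : 0 < cb := by positivity
  set m : ℕ := 6 * Fintype.card (Edge 3 L) with hm
  -- the rate as `b²` of `b = √(max 0 ·)`
  set R : ℝ → ℝ := fun β => 8 * (fpWeightBar L (powScale 1 β) * (1 + Cp * (43 * powScale s β) ^ 2)) * (Real.exp (-(β * gap * ((min (1 / 40) (powScale (1 / 2) β * btLog β)) / 12) ^ 2)) * Pm) /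
        ((1 - powScale (1 / 5) β) ^ 2 * (1 - Cq * (43 * powScale s β) ^ 2) *
          (∫ v, {v : Edge 3 L → Fin 3 → ℝ | ‖linkEmbed L v‖ ≤ (min (1 / 40) (powScale (1 / 2) β * btLog β)) / 12}.indicator (fun _ => (1 : ℝ)) v *
            (Real.exp (-(stiffGaussExp L (β / 2) β (linkEmbed L v))) ^ 2 * Real.exp (-(‖(gaugeModes L).starProjection (linkEmbed L v)‖ ^ 2 / powScale 1 β ^ 2))) ∂orthoTransverse L) *
          fpWeightBar L (powScale 1 β)) with hR
  set b : ℝ → ℝ := fun β => Real.sqrt (max 0 (R β)) with hb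
  have hκt : Tendsto (fun β : ℝ => (43 * powScale s β) ^ 2) atTop (𝓝 0) := by
    have h := ((tendsto_powScale hs).const_mul 43).pow 2
    rw [mul_zero, zero_pow two_ne_zero] at h; exact h
  have hκP : ∀ᶠ β : ℝ in atTop, Cp * (43 * powScale s β) ^ 2 ≤ 1 / 2 := by
    have h := hκt.const_mul Cp; rw [mul_zero] at h; exact h.eventually (eventually_le_nhds (by norm_num))
  have hκQ : ∀ᶠ β : ℝ in atTop, Cq * (43 * powScale s β) ^ 2 ≤ 1 / 2 := by
    have h := hκt.const_mul Cq; rw [mul_zero] at h; exact h.eventually (eventually_le_nhds (by norm_num))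
  have hη : ∀ᶠ β : ℝ in atTop, powScale (1 / 5) β ≤ 1 / 2 := (tendsto_powScale (σ := 1 / 5) (by norm_num)).eventually (eventually_le_nhds (by norm_num))
  have hb2 : ∀ᶠ β : ℝ in atTop, b β ^ 2 ≤ 96 * Pm / cb * Real.exp (-(gap / 144 * btLog β ^ 2)) / powScale 1 β ^ m := by
    filter_upwards [hκP, hκQ, hη, inner_mass_poly_floor (L := L), eventually_beta_mul_rf_sq] with β hκPβ hκQβ hηβ hM2 hrf
    set M2in : ℝ := ∫ v, {v : Edge 3 L → Fin 3 → ℝ | ‖linkEmbed L v‖ ≤ (min (1 / 40) (powScale (1 / 2) β * btLog β)) / 12}.indicator (fun _ => (1 : ℝ)) v *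
            (Real.exp (-(stiffGaussExp L (β / 2) β (linkEmbed L v))) ^ 2 * Real.exp (-(‖(gaugeModes L).starProjection (linkEmbed L v)‖ ^ 2 / powScale 1 β ^ 2))) ∂orthoTransverse L with hM2in
    have hps : 0 < powScale 1 β := powScale_pos 1 β
    have hfl : cb * powScale 1 β ^ m ≤ M2in := hM2
    have hfl0 : 0 < cb * powScale 1 β ^ m := by positivity
    have hM0 : 0 < M2in := lt_of_lt_of_le hfl0 hfl
    have hN : 0 < fpWeightBar L (powScale 1 β) := fpWeightBar_pos L hps
    set X : ℝ := Real.exp (-(gap / 144 * btLog β ^ 2)) with hX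
    have hG : Real.exp (-(β * gap * ((min (1 / 40) (powScale (1 / 2) β * btLog β)) / 12) ^ 2)) = X := by
      rw [hX]; congr 1
      have : β * gap * ((min (1 / 40) (powScale (1 / 2) β * btLog β)) / 12) ^ 2 = gap / 144 * (β * (min (1 / 40) (powScale (1 / 2) β * btLog β)) ^ 2) := by ring
      rw [this, hrf]
    have hrhs0 : 0 ≤ 96 * Pm / cb * X / powScale 1 β ^ m := by positivity
    rw [hb, Real.sq_sqrt (le_max_left _ _), max_le_iff]
    refine ⟨hrhs0, ?_⟩
    -- numerator ≤ `8·N̄·(3/2)·X·Pm`, denominator ≥ `(1/4)(1/2)·M2in·N̄`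
    have hnum : 8 * (fpWeightBar L (powScale 1 β) * (1 + Cp * (43 * powScale s β) ^ 2)) * (Real.exp (-(β * gap * ((min (1 / 40) (powScale (1 / 2) β * btLog β)) / 12) ^ 2)) * Pm) ≤
        8 * (fpWeightBar L (powScale 1 β) * (3 / 2)) * (X * Pm) := by
      rw [hG]; gcongr; linarith
    have hden : (1 / 2) ^ 2 * (1 / 2) * M2in * fpWeightBar L (powScale 1 β) ≤ (1 - powScale (1 / 5) β) ^ 2 * (1 - Cq * (43 * powScale s β) ^ 2) * M2in * fpWeightBar L (powScale 1 β) := by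
      have h1 : (1 / 2 : ℝ) ≤ 1 - powScale (1 / 5) β := by linarith
      have h2 : (1 / 2 : ℝ) ≤ 1 - Cq * (43 * powScale s β) ^ 2 := by linarith
      have h3 : (1 / 2 : ℝ) ^ 2 ≤ (1 - powScale (1 / 5) β) ^ 2 := pow_le_pow_left₀ (by norm_num) h1 2
      exact mul_le_mul_of_nonneg_right (mul_le_mul_of_nonneg_right (mul_le_mul h3 h2 (by norm_num) (by positivity)) hM0.le) hN.le
    have hden0 : 0 < (1 / 2 : ℝ) ^ 2 * (1 / 2) * M2in * fpWeightBar L (powScale 1 β) := by positivity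
    calc R β ≤ 8 * (fpWeightBar L (powScale 1 β) * (3 / 2)) * (X * Pm) / ((1 / 2) ^ 2 * (1 / 2) * M2in * fpWeightBar L (powScale 1 β)) := by
          simp only [hR]; exact div_le_div₀ (by positivity) hnum hden0 hden
      _ = 96 * Pm * X / M2in := by field_simp; ring
      _ ≤ 96 * Pm * X / (cb * powScale 1 β ^ m) := div_le_div_of_nonneg_left (by positivity) hfl0 hfl
      _ = 96 * Pm / cb * X / powScale 1 β ^ m := by field_simp
  have hsmall := sq_rate_small_of_exp_btLog_sq (L := L) (q := gap / 144) (by positivity) (P := 96 * Pm / cb) (by positivity) m (b := b)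
    (by filter_upwards [hb2] with β h; simpa [mul_div_assoc, div_div, mul_comm, mul_left_comm, mul_assoc] using h)
  intro a ha
  filter_upwards [hsmall a ha] with β hβ
  have h1 : R β ≤ b β ^ 2 := by rw [hb, Real.sq_sqrt (le_max_left _ _)]; exact le_max_right _ _
  exact h1.trans hβ

end Summit.QuantumFields.YangMills.Theorems.FemtoTransferGap.TwoLattice.ConstTube

end
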